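import Summits.QuantumFields.YangMills.Theorems.FluctuationComparisonRegPrIntLOrganTangentKnitV17
import Summits.QuantumFields.YangMills.Theorems.FluctuationComparisonRegPrIntLOrganTangentFibreMeanToolsAnyCut
import Summits.QuantumFields.YangMills.Theorems.BalabanUVNodesN09DomAltThresholdNull
import Literature.MathematicalPhysics.QuantumFieldTheory.Balaban1983to89.T3MinimiserStabilityReduction
import HarnessLib

/-!
# Crux `FluctuationComparisonRegPrIntL` (stmt-QuantumFields-20520, rung R3), PATH-B organ O1, LINE g25-3 «version_coarea» v1.4, row PINCH∘ `FibrePinchCan` —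
# THE v1.4 RE-LIFT (★★OWNER g40 WORD №214 (A) ASK): w5 g21's ✓p781960 `fibrePinch` discharged the v1.1 text; this file discharges the v1.4 text
# (O1 v17's frame: anchored runs, SF-projected below the seed, R-CUT-χ cutoff `(½, 24∕25)`), `sfCut` inlined as the token.

LEAD-20520 width seat ym-ust-20520-w3 g23 (cell ym3-torus), `--supports stmt-QuantumFields-20520` (helper).  THEOREMS ONLY, def-free; conclusion = tree
`Cruxes/FluctuationComparisonRegPrIntL/Lines/version_coarea.lean` v1.4 `FibrePinchCan` BODY with `sfCut θ U` inlined (the file's own `def sfCut`, unfolded).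

★`fibrePinchCan_v14`: for every organ height `j` (`j₀ ≤ j`, `j + 1 ≤ T`) the localised integrands `χ·(log ρ_{j+1} − log ρ′_{j+1})·ρ′_{j+1}` and `χ·ρ′_{j+1}`
are CONTINUOUS on the whole (compact) fine field space, the second is `≥ 0` everywhere and `> 0` on the `24∕25`-window — from clause ⑧ at `j+1` (window
positivity and window continuity of `ρ_{j+1}, ρ′_{j+1}`) and the ramp's properties (✓TOOLSc: continuous, `≥ 0`, `> 0` exactly on the `24∕25`-window, closed
support inside the `θ_{j+1}`-window since `24∕25 < 1`; ✓TOOLS `continuous_mul_of_tsupport_subset`).  Only clause ⑧ of the frame is used.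

With ✓p792023 COAREA∘ CLOSED this makes BOTH rows of LINE g25-3 theorems AT THE v1.4 TEXTS; the junction `fibreMeanVersion_of_coarea` (Lines) is then a second
kernel route to VER∘ (RECORD 17eq ∕ 17fa).

HONEST FRAMING: continuity bookkeeping; nothing of Bałaban's analysis is asserted or proved; O1, crux 20520, `YM3TorusSU2` NOT proved; registry
`Lines/semiclassical_s2beta.lean` v11.4 (★★OWNER RULING №36) untouched; rung R3 = SU(2) YM₃ on T³ — NOT d = 4, NOT infinite volume, NOT a mass gap, NOT Clay;
the Yang–Mills mass gap is NOT proved by any of this.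
-/

set_option autoImplicit false

noncomputable section

namespace Summit.QuantumFields.YangMills.Theorems.OrganTangentFibrePinchV14

open MeasureTheory ProbabilityTheory Filter Topology Set
open scoped ENNReal
open Literature.MathematicalPhysics.QuantumFieldTheory.Balaban1983to89 T3ContinuumYM3Torus T3NestedUnitLaws
  T3UnitLawDensityEML T4Continuum BalabanUVClass T3UnitScaleTilt
open Summit.QuantumFields.YangMills.Theorems.OrganTangentFibreMeanTools (continuous_mul_of_tsupport_subset)
open Summit.QuantumFields.YangMills.Theorems.OrganTangentFibreMeanToolsAnyCut
  (continuous_sfCutRamp sfCutRamp_nonneg sfCutRamp_pos_of_plaqSmall tsupport_sfCutRamp_subset half_lt_twentyFour_div_twentyFive_and_lt_one)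
open Summit.QuantumFields.YangMills.BalabanUVNodes.N09DomAltThresholdNull (isOpen_setOf_plaqSmall_SU)

/-- ★ **PINCH∘ at the v1.4 text** (`FibrePinchCan`, cutoff inlined). [cite: Balaban1985Averaging, (10)-(13) p.19; Balaban1987RG1, (0.13) p.254] -/
theorem fibrePinchCan_v14 :
    ∀ (F : T3Family) (γ b₀ p₀ : ℝ), 0 < γ → γ ≤ 1 → 0 < b₀ → 0 < p₀ → ∀ (j₀ : ℕ) (prm : ℕ → ClassParams) (η : ℕ → ℝ), ∀ (ν : ℕ → (j : ℕ) → MeasureTheory.Measure (GaugeField (F.P j) 0 ↥(Matrix.specialUnitaryGroup (Fin 2) ℂ))), (∀ K, ν K K = T4GenFunBounds.gibbsMeasure (F.P K) ((F.scheme ℰp γ).β K)) → (∀ K j, j < K → ν K j = Measure.map (descend F ℰp j) (ν K (j + 1))) → ∀ (K K' : ℕ), K ≤ K' → ∀ (Ts T : ℕ), Ts < T → T ≤ K → ∀ (μ μ' : ((j : ℕ) → MeasureTheory.Measure (GaugeField (F.P j) 0 ↥(Matrix.specialUnitaryGroup (Fin 2) ℂ)))) (ρ ρ' : ((j : ℕ)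 → GaugeField (F.P j) 0 ↥(Matrix.specialUnitaryGroup (Fin 2) ℂ) → ℝ)), (∀ j : ℕ, Ts ≤ j → j ≤ T → μ j = ν K j ∧ μ' j = ν K' j) → (∀ j : ℕ, j < Ts → μ j = Measure.map (descend F ℰp j) ((μ (j + 1)).withDensity (fun U => ENNReal.ofReal ((∏ p : Plaq (F.P (j + 1)) 0, max 0 (min 1 ((24 / 25 * θBal F.L γ b₀ p₀ (j + 1) - dist1 (GaugeField.plaqHol U p)) / ((24 / 25 - 1 / 2) * θBal F.L γ b₀ p₀ (j + 1)))))))) ∧ μ' j = Measure.map (descend F ℰp j) ((μ' (j + 1)).withDensity (fun U => ENNReal.ofReal ((∏ p : Plaq (F.P (j + 1)) 0, max 0 (min 1 ((24 / 25 * θBal F.L γ b₀ p₀ (j + 1) - dist1 (GaugeField.plaqHol U p)) / ((24 / 25 - 1 / 2) * θBal F.L γ b₀ p₀ (j + 1))))))))) → (∀ j : ℕ, Ts ≤ j → j < T → μ j = Measure.map (descend F ℰp j) (μ (j + 1)) ∧ μ' j = Measure.map (descend F ℰp j) (μ' (j + 1))) → (∀ j : ℕ, j ≤ T → IsFiniteMeasure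 (μ j) ∧ IsFiniteMeasure (μ' j)) → (∀ j : ℕ, j₀ ≤ j → j ≤ T → ((∀ U, PlaqSmall (θBal F.L γ b₀ p₀ j) U → 0 < ρ j U ∧ 0 < ρ' j U) ∧ μ j = (fieldMeasure _ _ _).withDensity (fun U => ENNReal.ofReal (ρ j U)) ∧ μ' j = (fieldMeasure _ _ _).withDensity (fun U => ENNReal.ofReal (ρ' j U)) ∧ (∃ κ : ℝ, MemAtHeight F ℰp j (prm j) (fun U => Real.exp κ * ρ j U)) ∧ (∃ κ : ℝ, MemAtHeight F ℰp j (prm j) (fun U => Real.exp κ * ρ' j U)) ∧ μ j {U | ¬ PlaqSmall (θBal F.L γ b₀ p₀ j) U} ≤ ENNReal.ofReal (η j) ∧ μ' j {U | ¬ PlaqSmall (θBal F.L γ b₀ p₀ j) U} ≤ ENNReal.ofReal (η j) ∧ (ContinuousOn (ρ j) {U | PlaqSmall (θBal F.L γ b₀ p₀ j) U} ∧ ContinuousOn (ρ' j) {U | PlaqSmall (θBal F.L γ b₀ p₀ j) U}))) → ∀ (j : ℕ), j₀ ≤ j → j + 1 ≤ T → Continuous (fun U => (∏ p : Plaq (F.P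 (j + 1)) 0, max 0 (min 1 ((24 / 25 * θBal F.L γ b₀ p₀ (j + 1) - dist1 (GaugeField.plaqHol U p)) / ((24 / 25 - 1 / 2) * θBal F.L γ b₀ p₀ (j + 1))))) * (Real.log (ρ (j + 1) U) - Real.log (ρ' (j + 1) U)) * ρ' (j + 1) U) ∧ Continuous (fun U => (∏ p : Plaq (F.P (j + 1)) 0, max 0 (min 1 ((24 / 25 * θBal F.L γ b₀ p₀ (j + 1) - dist1 (GaugeField.plaqHol U p)) / ((24 / 25 - 1 / 2) * θBal F.L γ b₀ p₀ (j + 1))))) * ρ' (j + 1) U) ∧ (∀ U, 0 ≤ (∏ p : Plaq (F.P (j + 1)) 0, max 0 (min 1 ((24 / 25 * θBal F.L γ b₀ p₀ (j + 1) - dist1 (GaugeField.plaqHol U p)) / ((24 / 25 - 1 / 2) * θBal F.L γ b₀ p₀ (j + 1))))) * ρ' (j + 1) U) ∧ (∀ U, PlaqSmall (24 / 25 * θBal F.L γ b₀ p₀ (j + 1)) U → 0 < (∏ p : Plaq (F.P (j + 1)) 0, max 0 (min 1 ((24 / 25 * θBal F.L γ b₀ p₀ (j + 1) - dist1 (GaugeField.plaqHol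 U p)) / ((24 / 25 - 1 / 2) * θBal F.L γ b₀ p₀ (j + 1))))) * ρ' (j + 1) U) := by
  intro F γ b₀ p₀ hγ hγ1 hb₀ hp₀ j₀ prm η ν hνK hνc K K' hKK' Ts T hTsT hTK μ μ' ρ ρ' hanch hcut huncut hfin hwin j hj₀ hjT
  have hθ : 0 < θBal F.L γ b₀ p₀ (j + 1) := T3MinimiserStabilityReduction.θBal_pos F.hL.2.le hγ hγ1 hb₀ p₀ (j + 1)
  have hc12 : (1 / 2 : ℝ) < 24 / 25 := half_lt_twentyFour_div_twentyFive_and_lt_one.1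
  have hcW : (24 / 25 : ℝ) < 1 := half_lt_twentyFour_div_twentyFive_and_lt_one.2
  have hw1 := hwin (j + 1) (by omega) hjT
  have hpos := hw1.1
  have hcρ : ContinuousOn (ρ (j + 1)) {U | PlaqSmall (θBal F.L γ b₀ p₀ (j + 1)) U} := hw1.2.2.2.2.2.2.2.1
  have hcρ' : ContinuousOn (ρ' (j + 1)) {U | PlaqSmall (θBal F.L γ b₀ p₀ (j + 1)) U} := hw1.2.2.2.2.2.2.2.2
  have hO : IsOpen {U : GaugeField (F.P (j + 1)) 0 ↥(Matrix.specialUnitaryGroup (Fin 2) ℂ) | PlaqSmall (θBal F.L γ b₀ p₀ (j + 1)) U} :=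
    isOpen_setOf_plaqSmall_SU 2 (F.P (j + 1)) 0 (θBal F.L γ b₀ p₀ (j + 1))
  have hχc := continuous_sfCutRamp (P := F.P (j + 1)) (k := 0) (1 / 2) (24 / 25) (θBal F.L γ b₀ p₀ (j + 1))
  have hχts := tsupport_sfCutRamp_subset (P := F.P (j + 1)) (k := 0) hc12 hcW hθ
  have hh : ContinuousOn (fun U => (Real.log (ρ (j + 1) U) - Real.log (ρ' (j + 1) U)) * ρ' (j + 1) U)
      {U | PlaqSmall (θBal F.L γ b₀ p₀ (j + 1)) U} :=
    ((hcρ.log fun U hU => (hpos U hU).1.ne').sub (hcρ'.log fun U hU => (hpos U hU).2.ne')).mul hcρ'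
  refine ⟨?_, ?_, fun U => ?_, fun U hU => ?_⟩
  · have h := continuous_mul_of_tsupport_subset hO hχc hχts hh
    refine h.congr fun U => ?_
    simp only [mul_assoc]
  · exact continuous_mul_of_tsupport_subset hO hχc hχts hcρ'
  · have hU : (0 : ℝ) ≤ ρ' (j + 1) U ∨ ¬ PlaqSmall (24 / 25 * θBal F.L γ b₀ p₀ (j + 1)) U := by
      by_cases h : PlaqSmall (24 / 25 * θBal F.L γ b₀ p₀ (j + 1)) U
      · exact Or.inl (hpos U fun p => (h p).trans (mul_lt_of_lt_one_left hθ hcW)).2.le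
      · exact Or.inr h
    rcases hU with h | h
    · exact mul_nonneg (sfCutRamp_nonneg _ _ _ U) h
    · have h0 : (∏ p : Plaq (F.P (j + 1)) 0, max 0 (min 1 ((24 / 25 * θBal F.L γ b₀ p₀ (j + 1) - dist1 (GaugeField.plaqHol U p)) /
          ((24 / 25 - 1 / 2) * θBal F.L γ b₀ p₀ (j + 1))))) = 0 :=
        le_antisymm (not_lt.mp fun h' =>
          h (OrganTangentFibreMeanToolsAnyCut.plaqSmall_of_sfCutRamp_ne_zero hc12 hθ U h'.ne')) (sfCutRamp_nonneg _ _ _ U)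
      rw [h0, zero_mul]
  · exact mul_pos (sfCutRamp_pos_of_plaqSmall hc12 hθ U hU) (hpos U fun p => (hU p).trans (mul_lt_of_lt_one_left hθ hcW)).2

end Summit.QuantumFields.YangMills.Theorems.OrganTangentFibrePinchV14

end
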